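import Literature.Computability.QuantumComplexity.PolynomialMethod
import Literature.Computability.QuantumComplexity.Symmetrization
import Literature.Computability.QuantumComplexity.ExactQuantumQuery
import Literature.Analysis.Approximation.EhlichZeller
import HarnessLib

/-!
# The `Ω(√N)` lower bound for quantum search: `Q₂(OR_N) ≥ √N / 4`

Beals–Buhrman–Cleve–Mosca–de Wolf, *Quantum lower bounds by polynomials*, J. ACM 48 (2001), §6:
"Since `bs(OR) = N`, Theorem 4.13 gives us a lower bound of `¼√N` on computing the OR with
bounded error probability […] so we have `Q₂(OR) ∈ Θ(√N)`", for the tree's query model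
`Literature.Computability.Cryptography.QQueryAlg` (`QuantumQuery.lean`) and its measure
`quantumQueryComplexity (1/3)` (`Q₂`). This is the lower half of the tree fact
`Literature.Computability.QuantumComplexity.grover_bbbv` (`QueryComplexity.lean`); the classical
source of the bound is Bennett–Bernstein–Brassard–Vazirani 1997 (Thm 3.5, hybrid argument) and
Boyer–Brassard–Høyer–Tapp 1998 (§7), Beals et al. re-derive it by the polynomial method, and that
is the proof assembled here from the tree's ingredients:

* `exists_polynomial_of_computesWithError` (`PolynomialMethod.lean`, Beals et al. Lemma 4.2 /
  Thm 4.13 proof): a `T`-query algorithm with error `1/3` for `OR_N` gives a real polynomial `P`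
  of degree `≤ 2T` with `0 ≤ P ≤ 1` on `{0,1}^N`, `P(0…0) ≤ 1/3`, `P(x) ≥ 2/3` for `x ≠ 0`;
* `symPoly` / `choose_mul_symPoly_eval` (`Symmetrization.lean`, Lemma 3.2): the symmetrization
  `r` of `P`, `deg r ≤ 2T`, `r(i)` = average of `P` over the inputs of weight `i ≤ N`, so
  `0 ≤ r(i) ≤ 1`, `r(0) ≤ 1/3`, `r(1) ≥ 2/3`;
* `le_four_mul_natDegree_sq` (`Analysis/Approximation/EhlichZeller.lean`, Thm 4.12 and the
  proof of Thm 4.13): hence `N ≤ 4 (deg r)² ≤ 16 T²`.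

For `OR_N` the block-sensitivity detour of Thm 4.13 is unnecessary (the sensitive blocks at
`0…0` are the singletons, i.e. one symmetrizes `P` itself), so block sensitivity is not
mentioned. Main statements: `le_sixteen_mul_queries_sq_of_computesWithError_orFn`
(`N ≤ 16 T²` for every bounded-error algorithm for `OR_N`, `N ≥ 1`) and
`sqrt_le_four_mul_quantumQueryComplexity_orFn` (`√N ≤ 4 · Q₂(OR_N)`, using that the infimum
defining `Q₂` is attained, `exists_queries_eq_quantumQueryComplexityOn`).

## References

* R. Beals, H. Buhrman, R. Cleve, M. Mosca, R. de Wolf, *Quantum lower bounds by polynomials*,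
  J. ACM 48 (2001) 778–797, Thm 4.13 and §6 (arXiv:quant-ph/9802049, pp. 9, 12; read via
  `lit read arxiv:quant-ph/9802049`) [BealsEtAl2001].
* C. H. Bennett, E. Bernstein, G. Brassard, U. Vazirani, *Strengths and weaknesses of quantum
  computing*, SIAM J. Comput. 26 (1997), Thm 3.5 [BennettBernsteinBrassardVazirani1997] (the
  original `Ω(√N)` bound, by the hybrid argument; not the proof used here).
-/

namespace Literature.Computability.QuantumComplexity

open MvPolynomial Finset Literature.Computability.Cryptography Literature.Computability.Complexity
  Literature.Analysis.Approximation

variable {N : ℕ}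

/-- The `0/1`-point of the characteristic vector of a set `S` of coordinates is the indicator
vector `1_S` of `Symmetrization.lean`. [folklore] -/
theorem boolPt_decide_mem (S : Finset (Fin N)) :
    Multilinear.boolPt (R := ℝ) (fun k => decide (k ∈ S)) = indicatorVec S := by
  funext k
  simp [Multilinear.boolPt, indicatorVec]

/-- `OR` of the characteristic vector of `S` is `true` iff `S` is nonempty. [folklore] -/
theorem orFn_decide_mem (S : Finset (Fin N)) :
    orFn N (fun k => decide (k ∈ S)) = decide S.Nonempty := by
  by_cases hS : S.Nonempty
  · rw [decide_eq_true hS, orFn_eq_true_iff]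
    obtain ⟨k, hk⟩ := hS
    exact ⟨k, decide_eq_true hk⟩
  · rw [decide_eq_false hS, Bool.eq_false_iff, Ne, orFn_eq_true_iff]
    rintro ⟨k, hk⟩
    exact hS ⟨k, of_decide_eq_true hk⟩

/-- **Beals et al. 2001, Thm 4.13 for `OR_N`** (the core estimate): every quantum query
algorithm computing `OR_N` (`N ≥ 1`) with error probability `≤ 1/3` on all inputs makes `T`
queries with `N ≤ 16 T²`. Proof: the acceptance probability is a polynomial `P` of degree `≤ 2T`
(Lemma 4.2); its symmetrization `r` (Lemma 3.2) has `0 ≤ r(i) ≤ 1` on `0, …, N`, `r(0) ≤ 1/3`,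
`r(1) ≥ 2/3`, so `N ≤ 4 deg(r)²` (Thm 4.12, Ehlich–Zeller / Rivlin–Cheney).
[cite: BealsEtAl2001, Thm 4.13 and §6] -/
theorem le_sixteen_mul_queries_sq_of_computesWithError_orFn [NeZero N] {A : QQueryAlg N}
    (hA : A.ComputesWithError (1 / 3) Set.univ (orFn N)) : N ≤ 16 * A.queries ^ 2 := by
  classical
  obtain ⟨P, hdeg, h01, htrue, hfalse⟩ := exists_polynomial_of_computesWithError hA
  set r : Polynomial ℝ := symPoly N P with hr
  -- values of `P` at the characteristic vectors of sets
  have hevalS : ∀ S : Finset (Fin N), MvPolynomial.eval (indicatorVec S) P =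
      MvPolynomial.eval (Multilinear.boolPt (R := ℝ) (fun k => decide (k ∈ S))) P := fun S => by
    rw [boolPt_decide_mem]
  have hS01 : ∀ S : Finset (Fin N),
      0 ≤ MvPolynomial.eval (indicatorVec S) P ∧ MvPolynomial.eval (indicatorVec S) P ≤ 1 :=
    fun S => by rw [hevalS]; exact h01 _
  have hSne : ∀ S : Finset (Fin N), S.Nonempty → 2 / 3 ≤ MvPolynomial.eval (indicatorVec S) P :=
    fun S hS => by
      rw [hevalS]
      have h := htrue (fun k => decide (k ∈ S)) (Set.mem_univ _)
        (by rw [orFn_decide_mem, decide_eq_true hS])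
      linarith
  have hSempty : MvPolynomial.eval (indicatorVec (∅ : Finset (Fin N))) P ≤ 1 / 3 := by
    rw [hevalS]
    exact hfalse _ (Set.mem_univ _) (by rw [orFn_decide_mem, decide_eq_false (by simp)])
  -- the symmetrization `r` : `C(N,i) · r(i) = ∑_{|S| = i} P(1_S)`
  have hkey : ∀ i : ℕ, (N.choose i : ℝ) * r.eval (i : ℝ) =
      ∑ S ∈ Finset.univ.powersetCard i, MvPolynomial.eval (indicatorVec S) P := fun i => by
    rw [hr]
    exact choose_mul_symPoly_eval P i
  have hcard : ∀ i : ℕ, ((Finset.univ : Finset (Fin N)).powersetCard i).card = N.choose i :=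
    fun i => by rw [Finset.card_powersetCard, Finset.card_univ, Fintype.card_fin]
  have hr01 : ∀ i : ℕ, i ≤ N → 0 ≤ r.eval (i : ℝ) ∧ r.eval (i : ℝ) ≤ 1 := by
    intro i hi
    have hpos : (0 : ℝ) < N.choose i := by exact_mod_cast Nat.choose_pos hi
    have hle : ∑ S ∈ Finset.univ.powersetCard i, MvPolynomial.eval (indicatorVec S) P ≤
        (N.choose i : ℝ) := by
      calc ∑ S ∈ Finset.univ.powersetCard i, MvPolynomial.eval (indicatorVec S) P
          ≤ ∑ _S ∈ (Finset.univ : Finset (Fin N)).powersetCard i, (1 : ℝ) :=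
            Finset.sum_le_sum fun S _ => (hS01 S).2
        _ = N.choose i := by rw [Finset.sum_const, hcard, nsmul_eq_mul, mul_one]
    have hge : (0 : ℝ) ≤ ∑ S ∈ Finset.univ.powersetCard i, MvPolynomial.eval (indicatorVec S) P :=
      Finset.sum_nonneg fun S _ => (hS01 S).1
    rw [← hkey i] at hle hge
    constructor
    · nlinarith
    · nlinarith
  have hr0 : r.eval 0 ≤ 1 / 3 := by
    have h := hkey 0
    rw [Nat.choose_zero_right, Nat.cast_one, one_mul, Finset.powersetCard_zero,
      Finset.sum_singleton, Nat.cast_zero] at h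
    rw [h]
    exact hSempty
  have hr1 : 2 / 3 ≤ r.eval 1 := by
    have h := hkey 1
    rw [Nat.choose_one_right, Nat.cast_one] at h
    have hNpos : (0 : ℝ) < N := by exact_mod_cast Nat.pos_of_ne_zero (NeZero.ne N)
    have hge : ((Finset.univ : Finset (Fin N)).powersetCard 1).card • (2 / 3 : ℝ) ≤
        ∑ S ∈ Finset.univ.powersetCard 1, MvPolynomial.eval (indicatorVec S) P :=
      Finset.card_nsmul_le_sum _ _ _ fun S hS => hSne S (by
        rw [Finset.mem_powersetCard] at hS
        exact Finset.card_pos.1 (by omega))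
    rw [hcard, Nat.choose_one_right, nsmul_eq_mul, ← h] at hge
    nlinarith
  -- Ehlich–Zeller / Rivlin–Cheney via `le_four_mul_natDegree_sq`
  have hb : 1 ≤ N := Nat.one_le_iff_ne_zero.2 (NeZero.ne N)
  have hdegr : r.natDegree ≤ 2 * A.queries := (natDegree_symPoly_le P).trans hdeg
  have h4 : N ≤ 4 * r.natDegree ^ 2 := le_four_mul_natDegree_sq hb hr01 hr0 hr1
  calc N ≤ 4 * r.natDegree ^ 2 := h4
    _ ≤ 4 * (2 * A.queries) ^ 2 := Nat.mul_le_mul_left 4 (Nat.pow_le_pow_left hdegr 2)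
    _ = 16 * A.queries ^ 2 := by ring

/-- **`Q₂(OR_N) ≥ √N / 4`** (Beals et al. 2001, §6: "Theorem 4.13 gives us a lower bound of
`¼√N` on computing the OR with bounded error probability"; originally
Bennett–Bernstein–Brassard–Vazirani 1997, Thm 3.5): for `N ≥ 1`,
`√N ≤ 4 · quantumQueryComplexity (1/3) (orFn N)`. (The infimum defining `Q₂` is attained,
`exists_queries_eq_quantumQueryComplexityOn`, and the optimal algorithm obeys
`le_sixteen_mul_queries_sq_of_computesWithError_orFn`.) [cite: BealsEtAl2001, §6] -/
theorem sqrt_le_four_mul_quantumQueryComplexity_orFn (hN : 1 ≤ N) :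
    Real.sqrt N ≤ 4 * (quantumQueryComplexity (1 / 3) (orFn N) : ℝ) := by
  haveI : NeZero N := NeZero.of_pos hN
  obtain ⟨A, hAq, hA⟩ := exists_queries_eq_quantumQueryComplexityOn (N := N) (ε := 1 / 3)
    (by norm_num) Set.univ (orFn N)
  have h := le_sixteen_mul_queries_sq_of_computesWithError_orFn hA
  rw [hAq] at h
  have h' : (N : ℝ) ≤ 16 * (quantumQueryComplexity (1 / 3) (orFn N) : ℝ) ^ 2 := by
    unfold quantumQueryComplexity
    exact_mod_cast h
  have hQ : (0 : ℝ) ≤ (quantumQueryComplexity (1 / 3) (orFn N) : ℝ) := Nat.cast_nonneg _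
  calc Real.sqrt N ≤ Real.sqrt ((4 * (quantumQueryComplexity (1 / 3) (orFn N) : ℝ)) ^ 2) :=
        Real.sqrt_le_sqrt (by nlinarith)
    _ = 4 * (quantumQueryComplexity (1 / 3) (orFn N) : ℝ) := Real.sqrt_sq (by positivity)

/-- The lower half of `grover_bbbv` in its `∃ c > 0` form: there is `c > 0` (namely `c = 1/4`)
with `c √N ≤ Q₂(OR_N)` for all `N ≥ 1`. [cite: BealsEtAl2001, §6] -/
theorem exists_pos_mul_sqrt_le_quantumQueryComplexity_orFn :
    ∃ c : ℝ, 0 < c ∧ ∀ N : ℕ, 1 ≤ N →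
      c * Real.sqrt N ≤ (quantumQueryComplexity (1 / 3) (orFn N) : ℝ) :=
  ⟨1 / 4, by norm_num, fun N hN => by
    have h := sqrt_le_four_mul_quantumQueryComplexity_orFn hN
    linarith⟩

end Literature.Computability.QuantumComplexity
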